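import Summits.RiemannHypothesis.RiemannHypothesis.Theorems.GroundBartaEvenWinsBeyondArchDeflationArchPanelsY
import Literature.NumberTheory.LFunctions.WeilMarkovThreePrime
import HarnessLib

/-!
# RiemannHypothesis / GroundBarta — rung 4 (`EvenWinsBeyondArch`, stmt-RiemannHypothesis-18807 / 18085):
# the deflated Temple L-side, A-layer IV — the prime increments of a scaled window polynomial on the `{2,3,4}`-window

Helper file (`--supports`), RH-free.  Prover A, speedrun unit `sr-gb-rung-a` (gen 2).

For `v(x) = 𝟙_{[-b,b]}(x) P(x/b)` with `log 2 < b ≤ (log 5)/2` and a certified increment polynomial `E`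
(`D_t(v) = t·E(t/b)` on `[0, 2b]`, `…ArchPanelsY`), the prime part of the Dirichlet energy is
`Σ_{n ∈ weilPrimeIndex b} Λ(n) n^{-1/2} D_{log n}(v) = (log 2)²/√2 · E(log 2/b) + (log 3)²/√3 · E(log 3/b) + (log 2)² E(log 4/b)`
(`sum_weilPrimeIndex_eq_threePrime`).  The values `E(τ_n)` at the irrational points `τ_n = log n/b` are enclosed by
RE-CENTRED interval Horner evaluation (`evalMI` of `taylorShiftH E L_n` at the tiny interval `τ_n − L_n`, `L_n` rational,
`MI.logNat`), the constants by `MI.logNat` and rational square-root brackets; `primeBoundsY`/`primeCheckY`/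
`dt_primeSum_windowPolyY_mem` is the kernel certificate.

References: E. Bombieri, Rend. Mat. Acc. Lincei (9) 11 (2000) 183–233, Thm 2 [Bombieri2000Weil].
-/

set_option linter.dupNamespace false

noncomputable section

open MeasureTheory Set
open scoped BigOperators

namespace Summit.RiemannHypothesis.RiemannHypothesis.Theorems.EvenWinsBeyondArch

open Literature.NumberTheory.LFunctions Literature.Analysis.ValidatedNumerics.ExpPoly
open Literature.Analysis.ValidatedNumerics.PolyMP Literature.Analysis.ValidatedNumerics.NumericsMP

/-! ## Interval Horner evaluation of a rational polynomial -/

/-- Horner evaluation of a rational coefficient list at an interval, in `MI` arithmetic at scale `S`. [folklore] -/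
def evalMI (S : ℕ) (p : Poly) (T : MI) : MI := p.foldr (fun c acc ↦ MI.add (ofRat S c) (MI.mul S T acc)) ⟨0, 0⟩

/-- Soundness of `evalMI`. [folklore] -/
theorem mem_evalMI {S : ℕ} (hS : 0 < S) {s : ℝ} {T : MI} (hT : MI.mem S s T) :
    ∀ p : Poly, MI.mem S (Poly.eval p s) (evalMI S p T)
  | [] => by
      simp only [evalMI, List.foldr_nil, Poly.eval_nil]
      exact ⟨by simp, by simp⟩
  | c :: p => by
      have ih := mem_evalMI hS hT p
      simp only [evalMI, List.foldr_cons, Poly.eval_cons] at ih ⊢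
      exact MI.mem_add (mem_ofRat S c) (MI.mem_mul hS hT ih)

/-- The `MI` interval with rational endpoints `[lo, hi]` (outward rounded). [folklore] -/
def ratBracketMI (S : ℕ) (lo hi : ℚ) : MI := ⟨(ofRat S lo).lo, (ofRat S hi).hi⟩

/-- [folklore] -/
theorem mem_ratBracketMI (S : ℕ) {x : ℝ} {lo hi : ℚ} (h1 : (lo : ℝ) ≤ x) (h2 : x ≤ (hi : ℝ)) :
    MI.mem S x (ratBracketMI S lo hi) := by
  have a := (mem_ofRat S lo).1
  have b := (mem_ofRat S hi).2
  have hS : (0 : ℝ) ≤ S := by positivity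
  exact ⟨a.trans (mul_le_mul_of_nonneg_right h1 hS), le_trans (mul_le_mul_of_nonneg_right h2 hS) b⟩

/-! ## The certificate -/

/-- The kernel enclosure `Y` of `log n` (junk if the enclosure fails, excluded by the check). [folklore] -/
def logNatMI (S K n : ℕ) : MI := (MI.logNat S K n).getD ⟨0, 0⟩

/-- [folklore] -/
theorem mem_logNatMI {S : ℕ} (hS : 0 < S) {K n : ℕ} (h : (MI.logNat S K n).isSome = true) :
    MI.mem S (Real.log n) (logNatMI S K n) := by
  obtain ⟨Y, hY⟩ := Option.isSome_iff_exists.1 h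
  have : logNatMI S K n = Y := by simp [logNatMI, hY]
  rw [this]
  exact MI.mem_logNat hS hY

/-- Enclosure of `E(log n / b)` by re-centred interval Horner at the rational centre `L`. [folklore] -/
def evalAtLogMI (S K : ℕ) (E : Poly) (b L : ℚ) (n : ℕ) : MI :=
  evalMI S (Poly.taylorShiftH E L) (MI.sub (MI.mul S (logNatMI S K n) (ofRat S (1 / b))) (ofRat S L))

/-- [folklore] -/
theorem mem_evalAtLogMI {S : ℕ} (hS : 0 < S) {K : ℕ} (E : Poly) (b L : ℚ) {n : ℕ}
    (h : (MI.logNat S K n).isSome = true) :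
    MI.mem S (Poly.eval E (Real.log n / b)) (evalAtLogMI S K E b L n) := by
  have hs : MI.mem S (Real.log n / b - L) (MI.sub (MI.mul S (logNatMI S K n) (ofRat S (1 / b))) (ofRat S L)) := by
    have := MI.mem_sub (MI.mem_mul hS (mem_logNatMI hS h) (mem_ofRat S (1 / b))) (mem_ofRat S L)
    convert this using 1
    push_cast; ring
  have := mem_evalMI hS hs (Poly.taylorShiftH E L)
  rwa [Poly.eval_taylorShiftH, add_sub_cancel] at this

/-- The prime-sum enclosure (scaled integers): `(log 2)²/√2 · E(log 2/b) + (log 3)²/√3 · E(log 3/b) + (log 2)² E(log 4/b)`,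
with `1/√n ∈ [ilo_n, ihi_n]` rational brackets. [folklore] -/
def primeBoundsY (S K : ℕ) (E : Poly) (b L2 L3 L4 i2lo i2hi i3lo i3hi : ℚ) : ℤ × ℤ :=
  let l2 : MI := logNatMI S K 2
  let l3 : MI := logNatMI S K 3
  let t2 : MI := MI.mul S (MI.mul S (MI.mul S l2 l2) (ratBracketMI S i2lo i2hi)) (evalAtLogMI S K E b L2 2)
  let t3 : MI := MI.mul S (MI.mul S (MI.mul S l3 l3) (ratBracketMI S i3lo i3hi)) (evalAtLogMI S K E b L3 3)
  let t4 : MI := MI.mul S (MI.mul S l2 l2) (evalAtLogMI S K E b L4 4)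
  let R : MI := MI.add (MI.add t2 t3) t4
  (R.lo, R.hi)

/-- The prime-sum check: the `log` enclosures succeed and the `1/√n` brackets are valid
(`ilo, ihi ≥ 0`, `ilo² n ≤ 1 ≤ ihi² n`). [folklore] -/
def primeCheckY (S K : ℕ) (i2lo i2hi i3lo i3hi : ℚ) : Bool :=
  (MI.logNat S K 2).isSome && (MI.logNat S K 3).isSome && (MI.logNat S K 4).isSome &&
    decide (0 ≤ i2lo) && decide (i2lo ^ 2 * 2 ≤ 1) && decide (0 ≤ i2hi) && decide (1 ≤ i2hi ^ 2 * 2) &&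
    decide (0 ≤ i3lo) && decide (i3lo ^ 2 * 3 ≤ 1) && decide (0 ≤ i3hi) && decide (1 ≤ i3hi ^ 2 * 3)

/-- `1/√n` from a bracket `ilo² n ≤ 1 ≤ ihi² n`, `ilo, ihi ≥ 0`. [folklore] -/
theorem inv_sqrt_mem_of_bracket {n : ℕ} (hn : 0 < n) {ilo ihi : ℚ} (h0 : 0 ≤ ilo) (h1 : ilo ^ 2 * n ≤ 1)
    (h0' : 0 ≤ ihi) (h2 : 1 ≤ ihi ^ 2 * n) : (ilo : ℝ) ≤ 1 / Real.sqrt n ∧ 1 / Real.sqrt n ≤ (ihi : ℝ) := by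
  have hn' : (0 : ℝ) < n := by exact_mod_cast hn
  have hsq : 0 < Real.sqrt n := Real.sqrt_pos.2 hn'
  have h1r : (ilo : ℝ) ^ 2 * n ≤ 1 := by exact_mod_cast h1
  have h2r : 1 ≤ (ihi : ℝ) ^ 2 * n := by exact_mod_cast h2
  have h0r : (0 : ℝ) ≤ ilo := by exact_mod_cast h0
  have h0r' : (0 : ℝ) ≤ ihi := by exact_mod_cast h0'
  constructor
  · rw [le_div_iff₀ hsq]
    have : (ilo * Real.sqrt n) ^ 2 ≤ 1 := by rw [mul_pow, Real.sq_sqrt hn'.le]; exact h1r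
    nlinarith [mul_nonneg h0r hsq.le]
  · rw [div_le_iff₀ hsq]
    have : 1 ≤ (ihi * Real.sqrt n) ^ 2 := by rw [mul_pow, Real.sq_sqrt hn'.le]; exact h2r
    nlinarith [mul_nonneg h0r' hsq.le]

/-- **Kernel-certified prime increments of a scaled window polynomial on the `{2,3,4}`-window.**
[cite: Bombieri2000Weil, Thm 2] -/
theorem dt_primeSum_windowPolyY_mem (P E : Poly) {b : ℚ} (hb2 : Real.log 2 < (b : ℝ)) (hb5 : (b : ℝ) ≤ Real.log 5 / 2)
    (hE : ∀ τ : ℝ, τ * Poly.eval E τ = Poly.eval (Poly.smul 2 (Poly.corr P P 1)) 0 - Poly.eval (Poly.smul 2 (Poly.corr P P 1)) τ)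
    {S K : ℕ} (hS : 0 < S) (L2 L3 L4 i2lo i2hi i3lo i3hi : ℚ) (hchk : primeCheckY S K i2lo i2hi i3lo i3hi = true) :
    ((primeBoundsY S K E b L2 L3 L4 i2lo i2hi i3lo i3hi).1 : ℝ) / S ≤
        ∑ n ∈ weilPrimeIndex (b : ℝ), (ArithmeticFunction.vonMangoldt n : ℝ) / Real.sqrt n *
          weilIncrement (fun x : ℝ ↦ (((Set.Icc (-(b : ℝ)) b).indicator (fun x ↦ Poly.eval P (x / b)) x : ℝ) : ℂ))
            (Real.log n) ∧
      ∑ n ∈ weilPrimeIndex (b : ℝ), (ArithmeticFunction.vonMangoldt n : ℝ) / Real.sqrt n *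
          weilIncrement (fun x : ℝ ↦ (((Set.Icc (-(b : ℝ)) b).indicator (fun x ↦ Poly.eval P (x / b)) x : ℝ) : ℂ))
            (Real.log n) ≤
        ((primeBoundsY S K E b L2 L3 L4 i2lo i2hi i3lo i3hi).2 : ℝ) / S := by
  unfold primeCheckY at hchk
  simp only [Bool.and_eq_true, decide_eq_true_eq] at hchk
  obtain ⟨⟨⟨⟨⟨⟨⟨⟨⟨⟨hl2, hl3⟩, hl4⟩, h20⟩, h21⟩, h22'⟩, h22⟩, h30⟩, h31⟩, h32'⟩, h32⟩ := hchk
  have hbpos : (0 : ℝ) < b := lt_trans (Real.log_pos (by norm_num)) hb2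
  have hbq : 0 < b := by exact_mod_cast hbpos
  have hlog2 : 0 < Real.log 2 := Real.log_pos (by norm_num)
  -- the three increments through `E`
  have hD : ∀ n : ℕ, 1 ≤ n → Real.log n ≤ 2 * (b : ℝ) →
      weilIncrement (fun x : ℝ ↦ (((Set.Icc (-(b : ℝ)) b).indicator (fun x ↦ Poly.eval P (x / b)) x : ℝ) : ℂ))
        (Real.log n) = Real.log n * Poly.eval E (Real.log n / b) := by
    intro n hn hle
    exact dt_weilIncrement_windowPolyY_of_le P E hbq hE (Real.log_nonneg (by exact_mod_cast hn)) hle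
  have hlog4 : Real.log (4 : ℕ) = 2 * Real.log 2 := by
    rw [show ((4 : ℕ) : ℝ) = 2 ^ 2 by norm_num, Real.log_pow]; ring
  have hle2 : Real.log (2 : ℕ) ≤ 2 * (b : ℝ) := by push_cast; linarith
  have hle3 : Real.log (3 : ℕ) ≤ 2 * (b : ℝ) := by
    push_cast
    have : Real.log 3 < Real.log 4 := Real.log_lt_log (by norm_num) (by norm_num)
    have h4 : Real.log 4 = 2 * Real.log 2 := by
      rw [show (4 : ℝ) = 2 ^ 2 by norm_num, Real.log_pow]; ring
    linarith
  have hle4 : Real.log (4 : ℕ) ≤ 2 * (b : ℝ) := by rw [hlog4]; linarith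
  rw [sum_weilPrimeIndex_eq_threePrime hb2 hb5, hD 2 (by norm_num) hle2, hD 3 (by norm_num) hle3, hD 4 (by norm_num) hle4]
  -- enclosures
  have m2 := mem_logNatMI hS hl2
  have m3 := mem_logNatMI hS hl3
  have e2 := mem_evalAtLogMI hS E b L2 hl2
  have e3 := mem_evalAtLogMI hS E b L3 hl3
  have e4 := mem_evalAtLogMI hS E b L4 hl4
  obtain ⟨i2a, i2b⟩ := inv_sqrt_mem_of_bracket (n := 2) (by norm_num) h20 h21 h22' h22
  obtain ⟨i3a, i3b⟩ := inv_sqrt_mem_of_bracket (n := 3) (by norm_num) h30 h31 h32' h32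
  have s2 := mem_ratBracketMI S i2a i2b
  have s3 := mem_ratBracketMI S i3a i3b
  have t2 := MI.mem_mul hS (MI.mem_mul hS (MI.mem_mul hS m2 m2) s2) e2
  have t3 := MI.mem_mul hS (MI.mem_mul hS (MI.mem_mul hS m3 m3) s3) e3
  have t4 := MI.mem_mul hS (MI.mem_mul hS m2 m2) e4
  have hR := MI.mem_add (MI.mem_add t2 t3) t4
  obtain ⟨hlo, hhi⟩ := hR
  have hSr : (0 : ℝ) < S := by exact_mod_cast hS
  -- identify the enclosed quantity with the three-prime sum
  have hval : Real.log (2 : ℕ) * Real.log (2 : ℕ) * (1 / Real.sqrt (2 : ℕ)) * Poly.eval E (Real.log (2 : ℕ) / b) +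
        Real.log (3 : ℕ) * Real.log (3 : ℕ) * (1 / Real.sqrt (3 : ℕ)) * Poly.eval E (Real.log (3 : ℕ) / b) +
        Real.log (2 : ℕ) * Real.log (2 : ℕ) * Poly.eval E (Real.log (4 : ℕ) / b) =
      Real.log 2 / Real.sqrt 2 * (Real.log (2 : ℕ) * Poly.eval E (Real.log (2 : ℕ) / b)) +
        Real.log 3 / Real.sqrt 3 * (Real.log (3 : ℕ) * Poly.eval E (Real.log (3 : ℕ) / b)) +
        Real.log 2 / 2 * (Real.log (4 : ℕ) * Poly.eval E (Real.log (4 : ℕ) / b)) := by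
    rw [hlog4]; push_cast; ring
  unfold primeBoundsY
  simp only []
  constructor
  · rw [div_le_iff₀ hSr, ← hval]; exact hlo
  · rw [le_div_iff₀ hSr, ← hval]; exact hhi

end Summit.RiemannHypothesis.RiemannHypothesis.Theorems.EvenWinsBeyondArch

end
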